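import Summits.AtomisticToContinuum.Crystallization.Theorems.FrustratedLawDichotomyFiniteClusterGapPrelude

/-!
# FrustratedLawDichotomy · `AperiodicFrustratedLawGap` (stmt-AtomisticToContinuum-27623) · the FINITE-CLUSTER case of the registered stub
# `stub_aperiodicErgodicGap`, and the stub's reduction to its infinite-configuration core (decomp-a2c, prover hand 2, structural share)

**Theorem (`eStar_lt_integral_rootEnergy_of_ae_finite`).**  Let `δ > 0` and let `P` be a point-stationary probability law (Mecke
identity, `IsPointStationaryLaw`) carried by rooted `δ`-hard-core configurations of `ℝ³` (`IsRootedHardCore δ`) which are almost surely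
FINITE (finitely many atoms).  Then `e⋆ = ⨅_Q e_LJ(Q) < ∫ rootEnergy V_LJ dP` — STRICTLY.  No finite cluster, however rooted, is an exact
Lennard-Jones minimiser in the Palm sense.  (Item 9229 gives `≤` for every point-stationary hard-core law; strictness is the content.)

Proof.  (1) **Uniform re-rooting** (`lintegral_eq_lintegral_avg_reroot`): the Mecke identity with the transport "the root sends mass
`Φ(μ)/#μ` to each of its points" gives `E_P Φ(μ) = E_P[(#μ)⁻¹ Σ_{y ∈ μ} Φ(θ_y μ)]` for every measurable `Φ ≥ 0` — under a point-stationary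
law a finite cluster is uniformly rooted.  (2) Applied to the two root functionals `Σ V_LJ^±` (through the prelude's truncated identity
kernel, for measurability) the mean root energy becomes the mean of the cluster average `E_LJ(S)/#S`, which is `> e⋆` pointwise by STRICT
PERIODISATION (`two_mul_card_mul_eStar_lt_sum_sum`, prelude); (3) a strictly positive integrable excess has strictly positive mean.

Consequences for the crux (§3, statements VERBATIM the registered stub `S_aperiodicErgodicGap` of the skeleton
`Cruxes/AperiodicFrustratedLawGap` birth file, sha256 dd3251ad731e…, with ONE extra hypothesis):
* `aperiodicErgodicGap_finiteCase` — the stub HOLDS for laws almost surely carried by finite configurations (texture (d), Nash (e),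
  aperiodicity and ergodicity idle);
* `aperiodicErgodicGap_iff_infiniteCase` — the stub is EQUIVALENT to its restriction to laws almost surely carried by INFINITE
  configurations: the event `{μ | μ univ = ∞}` is Giry-measurable and re-rooting invariant, so the stub's ergodicity clause splits every
  law into the finite case (this file) or the infinite case.  The declared residual therefore lives entirely on infinite aperiodic
  texture-charging Nash hard-core configurations.  All `[folklore]`.
-/

noncomputable section

namespace Summit.AtomisticToContinuum.Crystallization.Theorems.FrustratedLawDichotomyFiniteClusterGap

open MeasureTheory Metric Set Filter ProbabilityTheory
open scoped ENNReal Topology BigOperators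
open Literature.MathematicalPhysics.StatisticalMechanics Literature.Probability.Process
open Summit.AtomisticToContinuum.Crystallization.Theorems.ChargedEnergyGapNegative (E3 eStar)

/-! ## §1. Uniform re-rooting: the Mecke identity for finite clusters -/

section Transport

variable {δ : ℝ} {P : Measure (Measure E3)}

/-- **The root of a finite unimodular cluster is uniformly distributed over it.**  For a point-stationary law `P` carried by
FINITE rooted `δ`-hard-core configurations, an s-finite kernel `κ` equal to the identity on rooted hard-core configurations, and a
measurable `Φ ≥ 0`: `E_P Φ(μ) = E_P [ (μ univ)⁻¹ · Σ_{y ∈ μ} Φ(θ_y μ) ]` — the Mecke identity with the transport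
`g(μ, y) = Φ(μ)/μ(univ)` (the root spreads the mass `Φ(μ)` evenly over the points of its configuration). [folklore] -/
theorem lintegral_eq_lintegral_avg_reroot (hδ : 0 < δ) (κ : Kernel (Measure E3) E3) [IsSFiniteKernel κ]
    (hκ : ∀ μ : Measure E3, IsRootedHardCore δ μ → κ μ = μ)
    (hcore : ∀ᵐ μ ∂P, IsRootedHardCore δ μ) (hfin : ∀ᵐ μ ∂P, μ univ ≠ ∞) (hstat : IsPointStationaryLaw P)
    {Φ : Measure E3 → ℝ≥0∞} (hΦ : Measurable Φ) :
    ∫⁻ μ, Φ μ ∂P = ∫⁻ μ, (∫⁻ y, Φ (μ.map fun z => z - y) ∂μ) / μ univ ∂P := by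
  -- the transport `g(μ, y) = Φ(μ) / #μ` (through the kernel, for joint measurability)
  set g : Measure E3 → E3 → ℝ≥0∞ := fun μ _ => Φ μ / κ μ univ with hg_def
  have hg : Measurable (Function.uncurry g) :=
    (hΦ.comp measurable_fst).div ((Kernel.measurable_coe κ MeasurableSet.univ).comp measurable_fst)
  have key := hstat g hg
  have hroot : ∀ μ : Measure E3, IsRootedHardCore δ μ → μ univ ≠ 0 := fun μ hμ h => by
    have h1 := hμ.measure_zero_singleton
    have h2 : μ {0} ≤ μ univ := measure_mono (subset_univ _)
    rw [h, h1] at h2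
    exact one_ne_zero (le_zero_iff.1 h2)
  -- mass sent: `(Φ(μ)/#μ) · #μ = Φ(μ)`
  have hsent : ∀ᵐ μ ∂P, ∫⁻ y, g μ y ∂μ = Φ μ := by
    filter_upwards [hcore, hfin] with μ hμ hμfin
    simp only [hg_def, hκ μ hμ, lintegral_const]
    exact ENNReal.div_mul_cancel (hroot μ hμ) hμfin
  -- mass received: `Σ_y Φ(θ_y μ)/#(θ_y μ) = (Σ_y Φ(θ_y μ)) / #μ`
  have hrec : ∀ᵐ μ ∂P, ∫⁻ y, g (μ.map fun z => z - y) (-y) ∂μ = (∫⁻ y, Φ (μ.map fun z => z - y) ∂μ) / μ univ := by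
    filter_upwards [hcore] with μ hμ
    have hμ' := hμ
    obtain ⟨S, h0, hsep, rfl⟩ := hμ
    have hae : ∀ᵐ y ∂((Measure.count : Measure E3).restrict S),
        g (((Measure.count : Measure E3).restrict S).map fun z => z - y) (-y) =
          Φ (((Measure.count : Measure E3).restrict S).map fun z => z - y) *
            (((Measure.count : Measure E3).restrict S) univ)⁻¹ := by
      refine (ae_mem_of_sep hδ hsep).mono fun y hy => ?_
      have hy' : (Measure.count : Measure E3).restrict S {y} ≠ 0 := (count_restrict_singleton_ne_zero_iff S y).2 hy
      simp only [hg_def, hκ _ (hμ'.map_sub hy'), map_sub_univ, div_eq_mul_inv]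
    rw [lintegral_congr_ae hae, lintegral_mul_const' _ _ (ENNReal.inv_ne_top.2 (hroot _ hμ')), div_eq_mul_inv]
  rw [← lintegral_congr_ae hsent, key]
  exact lintegral_congr_ae hrec

end Transport

/-! ## §2. The finite-cluster gap -/

section Gap

variable {δ : ℝ} {P : Measure (Measure E3)}

/-- `max(a,0) − max(−a,0) = a`. [folklore] -/
private theorem max_zero_sub_max_neg_zero (a : ℝ) : max a 0 - max (-a) 0 = a := by
  rcases le_total 0 a with h | h
  · rw [max_eq_left h, max_eq_right (neg_nonpos.2 h)]; ring
  · rw [max_eq_right h, max_eq_left (neg_nonneg.2 h)]; ring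

/-- **No finite unimodular cluster is a Palm minimiser.**  For `δ > 0` and a point-stationary probability law `P` on rooted
`δ`-hard-core configurations of `ℝ³` which are almost surely finite (finitely many atoms), `e⋆ < E_P[rootEnergy V_LJ]`. [folklore] -/
theorem eStar_lt_integral_rootEnergy_of_ae_finite (hδ : 0 < δ) [IsProbabilityMeasure P]
    (hcore : ∀ᵐ μ ∂P, IsRootedHardCore δ μ) (hstat : IsPointStationaryLaw P)
    (hfin : ∀ᵐ μ ∂P, {p : E3 | μ {p} ≠ 0}.Finite) :
    eStar < ∫ μ, rootEnergy lennardJones μ ∂P := by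
  classical
  obtain ⟨κ, hκs, hκS⟩ := exists_kernel_eq_count_restrict hδ
  have hκ : ∀ μ : Measure E3, IsRootedHardCore δ μ → κ μ = μ := by
    rintro μ ⟨S, -, hsep, rfl⟩; exact hκS S hsep
  obtain ⟨hp, hm⟩ := measurable_ofReal_lennardJones_parts
  set p : E3 → ℝ≥0∞ := fun z => ENNReal.ofReal (lennardJones ‖z‖) with hp_def
  set m : E3 → ℝ≥0∞ := fun z => ENNReal.ofReal (-lennardJones ‖z‖) with hm_def
  set Cp : ℝ≥0∞ := ENNReal.ofReal (250 / 12 * δ⁻¹ ^ 12) with hCp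
  set Cm : ℝ≥0∞ := ENNReal.ofReal (250 / 6 * δ⁻¹ ^ 6) with hCm
  -- the two root functionals and their cluster averages, all through the kernel (measurability)
  set Hp : Measure E3 → ℝ≥0∞ := fun ν => ∫⁻ z, p z ∂(κ ν) with hHp_def
  set Hm : Measure E3 → ℝ≥0∞ := fun ν => ∫⁻ z, m z ∂(κ ν) with hHm_def
  set Gp : Measure E3 → ℝ≥0∞ := fun ν => (∫⁻ y, ∫⁻ z, p (z - y) ∂(κ ν) ∂(κ ν)) / κ ν univ with hGp_def
  set Gm : Measure E3 → ℝ≥0∞ := fun ν => (∫⁻ y, ∫⁻ z, m (z - y) ∂(κ ν) ∂(κ ν)) / κ ν univ with hGm_def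
  have hHp : Measurable Hp := hp.lintegral_kernel
  have hHm : Measurable Hm := hm.lintegral_kernel
  have hGp : Measurable Gp :=
    (Measurable.lintegral_kernel_prod_right (measurable_lintegral_kernel_sub κ hp)).div
      (Kernel.measurable_coe κ MeasurableSet.univ)
  have hGm : Measurable Gm :=
    (Measurable.lintegral_kernel_prod_right (measurable_lintegral_kernel_sub κ hm)).div
      (Kernel.measurable_coe κ MeasurableSet.univ)
  -- a.e. the configuration is a FINITE rooted hard-core counting measure
  have hfinS : ∀ᵐ μ ∂P, ∃ S : Set E3, (0 : E3) ∈ S ∧ (∀ x ∈ S, ∀ y ∈ S, x ≠ y → δ ≤ dist x y) ∧ S.Finite ∧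
      μ = (Measure.count : Measure E3).restrict S := by
    filter_upwards [hcore, hfin] with μ hμ hμfin
    obtain ⟨S, h0, hsep, rfl⟩ := hμ
    rw [setOf_count_restrict_singleton_ne_zero] at hμfin
    exact ⟨S, h0, hsep, hμfin, rfl⟩
  -- pointwise bounds on the root functionals
  have hbp : ∀ᵐ μ ∂P, Hp μ ≤ Cp := by
    filter_upwards [hcore] with μ hμ
    have hκμ := hκ μ hμ
    obtain ⟨S, h0, hsep, rfl⟩ := hμ
    have h := (lintegral_lennardJones_parts_map_sub_le hδ hsep h0).1
    simp only [sub_zero, Measure.map_id'] at h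
    simpa only [hHp_def, hκμ] using h
  have hbm : ∀ᵐ μ ∂P, Hm μ ≤ Cm := by
    filter_upwards [hcore] with μ hμ
    have hκμ := hκ μ hμ
    obtain ⟨S, h0, hsep, rfl⟩ := hμ
    have h := (lintegral_lennardJones_parts_map_sub_le hδ hsep h0).2
    simp only [sub_zero, Measure.map_id'] at h
    simpa only [hHm_def, hκμ] using h
  have hfinp : ∫⁻ μ, Hp μ ∂P ≠ ∞ := by
    refine ((lintegral_mono_ae hbp).trans_lt ?_).ne
    rw [lintegral_const, measure_univ, mul_one]; exact ENNReal.ofReal_lt_top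
  have hfinm : ∫⁻ μ, Hm μ ∂P ≠ ∞ := by
    refine ((lintegral_mono_ae hbm).trans_lt ?_).ne
    rw [lintegral_const, measure_univ, mul_one]; exact ENNReal.ofReal_lt_top
  -- uniform re-rooting: `E Hp = E Gp`, `E Hm = E Gm`
  have hfin' : ∀ᵐ μ ∂P, μ univ ≠ ∞ := by
    filter_upwards [hfinS] with μ ⟨S, h0, hsep, hS, hμS⟩
    rw [hμS, count_restrict_univ_of_finite hS]; exact ENNReal.natCast_ne_top _
  have htransport : ∀ {f : E3 → ℝ≥0∞}, Measurable f →
      ∫⁻ μ, (∫⁻ z, f z ∂(κ μ)) ∂P = ∫⁻ μ, (∫⁻ y, ∫⁻ z, f (z - y) ∂(κ μ) ∂(κ μ)) / κ μ univ ∂P := by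
    intro f hf
    rw [lintegral_eq_lintegral_avg_reroot hδ κ hκ hcore hfin' hstat hf.lintegral_kernel]
    refine lintegral_congr_ae ?_
    filter_upwards [hcore] with μ hμ
    have hμ' := hμ
    have hκμ := hκ μ hμ
    obtain ⟨S, h0, hsep, rfl⟩ := hμ
    rw [hκμ]
    congr 1
    refine lintegral_congr_ae ((ae_mem_of_sep hδ hsep).mono fun y hy => ?_)
    have hy' : (Measure.count : Measure E3).restrict S {y} ≠ 0 := (count_restrict_singleton_ne_zero_iff S y).2 hy
    show ∫⁻ b, f b ∂(κ (((Measure.count : Measure E3).restrict S).map fun z => z - y)) =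
      ∫⁻ z, f (z - y) ∂((Measure.count : Measure E3).restrict S)
    rw [hκ _ (hμ'.map_sub hy'), lintegral_map hf (measurable_sub_const y)]
  have hEp : ∫⁻ μ, Hp μ ∂P = ∫⁻ μ, Gp μ ∂P := htransport hp
  have hEm : ∫⁻ μ, Hm μ ∂P = ∫⁻ μ, Gm μ ∂P := htransport hm
  -- pointwise evaluation of the averages on a finite cluster, and the strict cluster inequality
  have hGval : ∀ᵐ μ ∂P, Gp μ ≠ ∞ ∧ Gm μ ≠ ∞ ∧ 2 * eStar < (Gp μ).toReal - (Gm μ).toReal := by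
    filter_upwards [hfinS] with μ ⟨S, h0, hsep, hS, hμS⟩
    subst hμS
    set T : Finset E3 := hS.toFinset with hT
    have h0T : (0 : E3) ∈ T := by rw [hT, Set.Finite.mem_toFinset]; exact h0
    have hTne : T.Nonempty := ⟨0, h0T⟩
    have hcard : (0 : ℝ) < T.card := by exact_mod_cast Finset.card_pos.2 hTne
    have hκμ := hκS S hsep
    have heval : ∀ {f : E3 → ℝ≥0∞},
        (∫⁻ y, ∫⁻ z, f (z - y) ∂(κ ((Measure.count : Measure E3).restrict S))
            ∂(κ ((Measure.count : Measure E3).restrict S))) / κ ((Measure.count : Measure E3).restrict S) univ =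
          (∑ y ∈ T, ∑ z ∈ T, f (z - y)) / (T.card : ℝ≥0∞) := by
      intro f
      rw [hκμ, count_restrict_univ_of_finite hS, lintegral_count_restrict_of_finite hS]
      simp_rw [lintegral_count_restrict_of_finite hS]
      rfl
    have hreal : ∀ (v : E3 → E3 → ℝ),
        ((∑ y ∈ T, ∑ z ∈ T, ENNReal.ofReal (v y z)) / (T.card : ℝ≥0∞)).toReal =
          (∑ y ∈ T, ∑ z ∈ T, max (v y z) 0) / T.card := by
      intro v
      rw [ENNReal.toReal_div, ENNReal.toReal_natCast, ENNReal.toReal_sum fun y _ => ?_]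
      · congr 1
        refine Finset.sum_congr rfl fun y _ => ?_
        rw [ENNReal.toReal_sum fun z _ => ENNReal.ofReal_ne_top]
        exact Finset.sum_congr rfl fun z _ => ENNReal.toReal_ofReal' 
      · exact ENNReal.sum_ne_top.2 fun z _ => ENNReal.ofReal_ne_top
    have hGp' : Gp ((Measure.count : Measure E3).restrict S) =
        (∑ y ∈ T, ∑ z ∈ T, ENNReal.ofReal (lennardJones ‖z - y‖)) / (T.card : ℝ≥0∞) := heval
    have hGm' : Gm ((Measure.count : Measure E3).restrict S) =
        (∑ y ∈ T, ∑ z ∈ T, ENNReal.ofReal (-lennardJones ‖z - y‖)) / (T.card : ℝ≥0∞) := heval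
    have hne : ∀ (w : E3 → E3 → ℝ), (∑ y ∈ T, ∑ z ∈ T, ENNReal.ofReal (w y z)) / (T.card : ℝ≥0∞) ≠ ∞ := fun w =>
      ENNReal.div_ne_top (ENNReal.sum_ne_top.2 fun y _ => ENNReal.sum_ne_top.2 fun z _ => ENNReal.ofReal_ne_top)
        (by exact_mod_cast (Finset.card_pos.2 hTne).ne')
    refine ⟨by rw [hGp']; exact hne fun y z => lennardJones ‖z - y‖,
      by rw [hGm']; exact hne fun y z => -lennardJones ‖z - y‖, ?_⟩
    rw [hGp', hGm', hreal (fun y z => lennardJones ‖z - y‖), hreal (fun y z => -lennardJones ‖z - y‖), ← sub_div,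
      ← Finset.sum_sub_distrib]
    simp_rw [← Finset.sum_sub_distrib, max_zero_sub_max_neg_zero]
    rw [lt_div_iff₀ hcard]
    have := two_mul_card_mul_eStar_lt_sum_sum T hTne
    linarith
  -- pass to real-valued integrands
  have hintGp : Integrable (fun μ => (Gp μ).toReal) P :=
    integrable_toReal_of_lintegral_ne_top hGp.aemeasurable (hEp ▸ hfinp)
  have hintGm : Integrable (fun μ => (Gm μ).toReal) P :=
    integrable_toReal_of_lintegral_ne_top hGm.aemeasurable (hEm ▸ hfinm)
  -- the root energy as the difference of the two root functionals
  have hLJm : Measurable fun y : E3 => lennardJones ‖y‖ := by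
    have : Measurable lennardJones := by unfold lennardJones; fun_prop
    exact this.comp measurable_norm
  have hae : ∀ᵐ μ ∂P, rootEnergy lennardJones μ = ((Hp μ).toReal - (Hm μ).toReal) / 2 := by
    filter_upwards [hcore, hbp, hbm] with μ hμ hμp hμm
    have hκμ := hκ μ hμ
    have hHpμ : Hp μ = ∫⁻ z, p z ∂μ := by simp only [hHp_def, hκμ]
    have hHmμ : Hm μ = ∫⁻ z, m z ∂μ := by simp only [hHm_def, hκμ]
    rw [hHpμ] at hμp
    rw [hHmμ] at hμm
    have hint : Integrable (fun y : E3 => lennardJones ‖y‖) μ := by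
      refine ⟨hLJm.aestronglyMeasurable, ?_⟩
      show ∫⁻ y, ‖lennardJones ‖y‖‖ₑ ∂μ < ∞
      calc ∫⁻ y, ‖lennardJones ‖y‖‖ₑ ∂μ ≤ ∫⁻ y, (p y + m y) ∂μ := lintegral_mono fun y => by
              simp only [hp_def, hm_def]
              rw [Real.enorm_eq_ofReal_abs]
              rcases le_total 0 (lennardJones ‖y‖) with h | h
              · rw [abs_of_nonneg h]; exact le_self_add
              · rw [abs_of_nonpos h]; exact le_add_self
        _ = (∫⁻ y, p y ∂μ) + ∫⁻ y, m y ∂μ := lintegral_add_left hp _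
        _ < ∞ := ENNReal.add_lt_top.2 ⟨hμp.trans_lt ENNReal.ofReal_lt_top, hμm.trans_lt ENNReal.ofReal_lt_top⟩
    rw [rootEnergy_def, integral_eq_lintegral_pos_part_sub_lintegral_neg_part hint, hHpμ, hHmμ]
  rw [integral_congr_ae hae]
  have hintp : Integrable (fun μ => (Hp μ).toReal) P := integrable_toReal_of_lintegral_ne_top hHp.aemeasurable hfinp
  have hintm : Integrable (fun μ => (Hm μ).toReal) P := integrable_toReal_of_lintegral_ne_top hHm.aemeasurable hfinm
  rw [integral_div, integral_sub hintp hintm,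
    integral_toReal hHp.aemeasurable (hbp.mono fun μ h => h.trans_lt ENNReal.ofReal_lt_top),
    integral_toReal hHm.aemeasurable (hbm.mono fun μ h => h.trans_lt ENNReal.ofReal_lt_top), hEp, hEm,
    ← integral_toReal hGp.aemeasurable (hGval.mono fun μ h => lt_top_iff_ne_top.2 h.1),
    ← integral_toReal hGm.aemeasurable (hGval.mono fun μ h => lt_top_iff_ne_top.2 h.2.1),
    ← integral_sub hintGp hintGm]
  -- strict positivity of the averaged excess
  set F : Measure E3 → ℝ := fun μ => (Gp μ).toReal - (Gm μ).toReal - 2 * eStar with hF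
  have hFpos : ∀ᵐ μ ∂P, 0 < F μ := hGval.mono fun μ h => by simp only [hF]; linarith [h.2.2]
  have hFint : Integrable F P := (hintGp.sub hintGm).sub (integrable_const _)
  have hFI : 0 < ∫ μ, F μ ∂P := by
    have h0 : 0 ≤ ∫ μ, F μ ∂P := integral_nonneg_of_ae (hFpos.mono fun μ h => h.le)
    rcases h0.lt_or_eq with h | h
    · exact h
    · exfalso
      have hz := (integral_eq_zero_iff_of_nonneg_ae (hFpos.mono fun μ h => h.le) hFint).1 h.symm
      have hfalse : ∀ᵐ μ ∂P, False := by
        filter_upwards [hFpos, hz] with μ h1 h2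
        simp only [Pi.zero_apply] at h2
        linarith
      exact IsProbabilityMeasure.ne_zero P (ae_eq_bot.1 (Filter.eventually_false_iff_eq_bot.1 hfalse))
  have hsplit : ∫ μ, ((Gp μ).toReal - (Gm μ).toReal) ∂P = ∫ μ, F μ ∂P + 2 * eStar := by
    have : (fun μ => (Gp μ).toReal - (Gm μ).toReal) = fun μ => F μ + 2 * eStar := by
      funext μ; simp only [hF]; ring
    rw [this, integral_add hFint (integrable_const _), integral_const]
    simp
  rw [hsplit]
  linarith

end Gap

/-! ## §3. The registered stub: its finite-configuration case, and its reduction to the infinite-configuration core -/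

section Stub

/-- **The registered stub `stub_aperiodicErgodicGap` HOLDS on laws almost surely carried by FINITE configurations** (its statement
`S_aperiodicErgodicGap` verbatim, with the one extra hypothesis `∀ᵐ μ ∂P, {p | μ {p} ≠ 0}.Finite` before the conclusion; hypotheses (d),
(e), aperiodicity and ergodicity are idle). [folklore] -/
theorem aperiodicErgodicGap_finiteCase :
    ∀ δ : ℝ, 0 < δ → ∀ P : MeasureTheory.Measure (MeasureTheory.Measure (EuclideanSpace ℝ (Fin 3))), let Gy : ℝ → (N : ℕ) → (Fin N → EuclideanSpace ℝ (Fin 3)) → Fin N → Prop := fun η N y j => let d : ℝ := sInf ((fun z => dist z (y (j : Fin N))) '' (Set.range (y) \ {(y (j : Fin N))})); let T : Set (EuclideanSpace ℝ (Fin 3)) := {z : EuclideanSpace ℝ (Fin 3) | z ∈ Set.range (y) ∧ z ≠ (y (j : Fin N)) ∧ dist z (y (j : Fin N)) < 13 / 10 * d}; ∃ A : EuclideanSpace ℝ (Fin 3) →ₗᵢ[ℝ] EuclideanSpace ℝ (Fin 3), (∃ e : ↥T ≃ ↥Literature.Geometry.DiscreteGeometry.fccKissingPattern, ∀ t : ↥T,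 dist (d⁻¹ • ((t : EuclideanSpace ℝ (Fin 3)) - (y (j : Fin N)))) (A ((e t : ↥Literature.Geometry.DiscreteGeometry.fccKissingPattern) : EuclideanSpace ℝ (Fin 3))) ≤ η) ∨ (∃ e : ↥T ≃ ↥Literature.Geometry.DiscreteGeometry.hcpKissingPattern, ∀ t : ↥T, dist (d⁻¹ • ((t : EuclideanSpace ℝ (Fin 3)) - (y (j : Fin N)))) (A ((e t : ↥Literature.Geometry.DiscreteGeometry.hcpKissingPattern) : EuclideanSpace ℝ (Fin 3))) ≤ η); let TexBall : (N : ℕ) → (Fin N → EuclideanSpace ℝ (Fin 3)) → Fin N → ℝ → ℝ → ℝ → ℝ → Prop := fun N y i R R₇ R₈ R₉ => (∀ a b : Fin N, a ≠ b → (7 : ℝ) / 10 ≤ dist (y a) (y b)) ∧ (∀ j : Fin N, dist (y j) (y i) ≤ R → ¬ Gy (1 / 20) N (y) j) ∧ (∀ j : Fin N, dist (y j) (y i) ≤ R → ¬ ((∀ j' : Fin N, dist (y j') (y j) ≤ R₇ → ¬ Gy (1 / 20) N (y) j') ∧ (∀ z : EuclideanSpace ℝ (Fin 3), dist z (y j)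 ≤ R₇ → ∃ k : Fin N, dist z (y k) ≤ 1) ∧ (∀ j' : Fin N, dist (y j') (y j) ≤ R₇ → (let d : ℝ := sInf ((fun z => dist z (y j')) '' (Set.range (y) \ {(y j')})); ∀ k : Fin N, y k ≠ y j' → dist (y k) (y j') < 27 / 20 * d → 5 ≤ Nat.card {m : Fin N // y m ≠ y j' ∧ dist (y m) (y j') < 27 / 20 * d ∧ y m ≠ y k ∧ dist (y m) (y k) < 27 / 20 * d})))) ∧ (∀ j : Fin N, dist (y j) (y i) ≤ R → ∃ k : Fin N, dist (y k) (y j) ≤ R₈ ∧ Gy (1 / 8) N (y) k) ∧ (∀ j : Fin N, dist (y j) (y i) ≤ R → ¬ ((∀ j' : Fin N, dist (y j') (y j) ≤ R₉ → ¬ Gy (1 / 20) N (y) j') ∧ (Nat.card {j' : Fin N // dist (y j') (y j) ≤ R₉ ∧ ¬ Gy (1 / 8) N (y) j'} : ℝ) ≤ 1 / 2 * (Nat.card {j' : Fin N // dist (y j') (y j) ≤ R₉} : ℝ) ∧ (∀ j' : Fin N, dist (y j') (y j) ≤ R₉ → ¬ Gy (1 / 8) N (y) j' → ¬ (let d : ℝ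 := sInf ((fun z => dist z (y j')) '' (Set.range (y) \ {(y j')})); ∀ k : Fin N, y k ≠ y j' → dist (y k) (y j') < 27 / 20 * d → 5 ≤ Nat.card {m : Fin N // y m ≠ y j' ∧ dist (y m) (y j') < 27 / 20 * d ∧ y m ≠ y k ∧ dist (y m) (y k) < 27 / 20 * d})))); let Appr : MeasureTheory.Measure (EuclideanSpace ℝ (Fin 3)) → ℝ → ℝ → ℝ → Prop := fun μ R₇ R₈ R₉ => ∀ q : EuclideanSpace ℝ (Fin 3), μ {q} ≠ 0 → ∀ R ε : ℝ, 0 < ε → ∃ (N : ℕ) (y : Fin N → EuclideanSpace ℝ (Fin 3)) (i : Fin N), TexBall N y i R R₇ R₈ R₉ ∧ (∀ p : EuclideanSpace ℝ (Fin 3), μ {p} ≠ 0 → dist p q ≤ R → ∃ k : Fin N, dist (y k - y i) (p - q) ≤ ε) ∧ (∀ k : Fin N, dist (y k) (y i) ≤ R → ∃ p : EuclideanSpace ℝ (Fin 3), μ {p} ≠ 0 ∧ dist (y k - y i) (p - q) ≤ ε); MeasureTheory.IsProbabilityMeasure P → (∀ᵐ μ ∂P, Literature.Probability.Process.IsRootedHardCore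 δ μ) → Literature.Probability.Process.IsPointStationaryLaw P → (∃ R₇ R₈ R₉ : ℝ, ∀ᵐ μ ∂P, Appr μ R₇ R₈ R₉) → (∀ᵐ μ ∂P, ∀ p : EuclideanSpace ℝ (Fin 3), μ {p} ≠ 0 → ∀ y : EuclideanSpace ℝ (Fin 3), (∀ q : EuclideanSpace ℝ (Fin 3), μ {q} ≠ 0 → q ≠ p → y ≠ q) → ∑' q : {q : EuclideanSpace ℝ (Fin 3) // μ {q} ≠ 0 ∧ q ≠ p}, Literature.MathematicalPhysics.StatisticalMechanics.lennardJones (dist p (q : EuclideanSpace ℝ (Fin 3))) ≤ ∑' q : {q : EuclideanSpace ℝ (Fin 3) // μ {q} ≠ 0 ∧ q ≠ p}, Literature.MathematicalPhysics.StatisticalMechanics.lennardJones (dist y (q : EuclideanSpace ℝ (Fin 3)))) → P {μ : MeasureTheory.Measure (EuclideanSpace ℝ (Fin 3)) | ∃ Q : Literature.MathematicalPhysics.StatisticalMechanics.PeriodicConfiguration 3, ∃ t : EuclideanSpace ℝ (Fin 3), {p : EuclideanSpace ℝ (Fin 3) | μ {p} ≠ 0} = (fun s => s + t) '' Q.points}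 = 0 → (∀ A : Set (MeasureTheory.Measure (EuclideanSpace ℝ (Fin 3))), MeasurableSet A → (∀ μ : MeasureTheory.Measure (EuclideanSpace ℝ (Fin 3)), ∀ p : EuclideanSpace ℝ (Fin 3), μ {p} ≠ 0 → (μ ∈ A ↔ MeasureTheory.Measure.map (fun z : EuclideanSpace ℝ (Fin 3) => z - p) μ ∈ A)) → P A = 0 ∨ P Aᶜ = 0) → (∀ᵐ μ ∂P, {p : EuclideanSpace ℝ (Fin 3) | μ {p} ≠ 0}.Finite) → (⨅ Q : Literature.MathematicalPhysics.StatisticalMechanics.PeriodicConfiguration 3, Q.energyPerParticle Literature.MathematicalPhysics.StatisticalMechanics.lennardJones) < (∫ μ, Literature.MathematicalPhysics.StatisticalMechanics.rootEnergy Literature.MathematicalPhysics.StatisticalMechanics.lennardJones μ ∂P) := by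
  intro δ hδ P
  dsimp only
  intro _hP ha hb _ _ _ _ hfin
  exact eStar_lt_integral_rootEnergy_of_ae_finite hδ ha hb hfin

/-- **EXACT CUT of the registered stub**: `S_aperiodicErgodicGap` (verbatim, left) is EQUIVALENT to its restriction to laws almost surely
carried by INFINITE configurations (right: the same statement with the extra hypothesis `∀ᵐ μ ∂P, {p | μ {p} ≠ 0}.Infinite`).  The event
`{μ | μ univ = ∞}` is Giry-measurable and re-rooting invariant, so the stub's own ergodicity clause puts almost every configuration in the
finite case (`aperiodicErgodicGap_finiteCase`) or in the infinite one. [folklore] -/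
theorem aperiodicErgodicGap_iff_infiniteCase :
    (∀ δ : ℝ, 0 < δ → ∀ P : MeasureTheory.Measure (MeasureTheory.Measure (EuclideanSpace ℝ (Fin 3))), let Gy : ℝ → (N : ℕ) → (Fin N → EuclideanSpace ℝ (Fin 3)) → Fin N → Prop := fun η N y j => let d : ℝ := sInf ((fun z => dist z (y (j : Fin N))) '' (Set.range (y) \ {(y (j : Fin N))})); let T : Set (EuclideanSpace ℝ (Fin 3)) := {z : EuclideanSpace ℝ (Fin 3) | z ∈ Set.range (y) ∧ z ≠ (y (j : Fin N)) ∧ dist z (y (j : Fin N)) < 13 / 10 * d}; ∃ A : EuclideanSpace ℝ (Fin 3) →ₗᵢ[ℝ] EuclideanSpace ℝ (Fin 3), (∃ e : ↥T ≃ ↥Literature.Geometry.DiscreteGeometry.fccKissingPattern, ∀ t : ↥T, dist (d⁻¹ • ((t : EuclideanSpace ℝ (Fin 3)) - (y (j : Fin N)))) (A ((e t : ↥Literature.Geometry.DiscreteGeometry.fccKissingPattern) : EuclideanSpace ℝ (Fin 3))) ≤ η) ∨ (∃ e : ↥T ≃ ↥Literature.Geometry.DiscreteGeometry.hcpKissingPattern,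 ∀ t : ↥T, dist (d⁻¹ • ((t : EuclideanSpace ℝ (Fin 3)) - (y (j : Fin N)))) (A ((e t : ↥Literature.Geometry.DiscreteGeometry.hcpKissingPattern) : EuclideanSpace ℝ (Fin 3))) ≤ η); let TexBall : (N : ℕ) → (Fin N → EuclideanSpace ℝ (Fin 3)) → Fin N → ℝ → ℝ → ℝ → ℝ → Prop := fun N y i R R₇ R₈ R₉ => (∀ a b : Fin N, a ≠ b → (7 : ℝ) / 10 ≤ dist (y a) (y b)) ∧ (∀ j : Fin N, dist (y j) (y i) ≤ R → ¬ Gy (1 / 20) N (y) j) ∧ (∀ j : Fin N, dist (y j) (y i) ≤ R → ¬ ((∀ j' : Fin N, dist (y j') (y j) ≤ R₇ → ¬ Gy (1 / 20) N (y) j') ∧ (∀ z : EuclideanSpace ℝ (Fin 3), dist z (y j) ≤ R₇ → ∃ k : Fin N, dist z (y k) ≤ 1) ∧ (∀ j' : Fin N, dist (y j') (y j) ≤ R₇ → (let d : ℝ := sInf ((fun z => dist z (y j')) '' (Set.range (y) \ {(y j')})); ∀ k : Fin N, y k ≠ y j' → dist (y k) (y j') < 27 / 20 * d → 5 ≤ Nat.card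 {m : Fin N // y m ≠ y j' ∧ dist (y m) (y j') < 27 / 20 * d ∧ y m ≠ y k ∧ dist (y m) (y k) < 27 / 20 * d})))) ∧ (∀ j : Fin N, dist (y j) (y i) ≤ R → ∃ k : Fin N, dist (y k) (y j) ≤ R₈ ∧ Gy (1 / 8) N (y) k) ∧ (∀ j : Fin N, dist (y j) (y i) ≤ R → ¬ ((∀ j' : Fin N, dist (y j') (y j) ≤ R₉ → ¬ Gy (1 / 20) N (y) j') ∧ (Nat.card {j' : Fin N // dist (y j') (y j) ≤ R₉ ∧ ¬ Gy (1 / 8) N (y) j'} : ℝ) ≤ 1 / 2 * (Nat.card {j' : Fin N // dist (y j') (y j) ≤ R₉} : ℝ) ∧ (∀ j' : Fin N, dist (y j') (y j) ≤ R₉ → ¬ Gy (1 / 8) N (y) j' → ¬ (let d : ℝ := sInf ((fun z => dist z (y j')) '' (Set.range (y) \ {(y j')})); ∀ k : Fin N, y k ≠ y j' → dist (y k) (y j') < 27 / 20 * d → 5 ≤ Nat.card {m : Fin N // y m ≠ y j' ∧ dist (y m) (y j') < 27 / 20 * d ∧ y m ≠ y k ∧ dist (y m) (y k) < 27 / 20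 * d})))); let Appr : MeasureTheory.Measure (EuclideanSpace ℝ (Fin 3)) → ℝ → ℝ → ℝ → Prop := fun μ R₇ R₈ R₉ => ∀ q : EuclideanSpace ℝ (Fin 3), μ {q} ≠ 0 → ∀ R ε : ℝ, 0 < ε → ∃ (N : ℕ) (y : Fin N → EuclideanSpace ℝ (Fin 3)) (i : Fin N), TexBall N y i R R₇ R₈ R₉ ∧ (∀ p : EuclideanSpace ℝ (Fin 3), μ {p} ≠ 0 → dist p q ≤ R → ∃ k : Fin N, dist (y k - y i) (p - q) ≤ ε) ∧ (∀ k : Fin N, dist (y k) (y i) ≤ R → ∃ p : EuclideanSpace ℝ (Fin 3), μ {p} ≠ 0 ∧ dist (y k - y i) (p - q) ≤ ε); MeasureTheory.IsProbabilityMeasure P → (∀ᵐ μ ∂P, Literature.Probability.Process.IsRootedHardCore δ μ) → Literature.Probability.Process.IsPointStationaryLaw P → (∃ R₇ R₈ R₉ : ℝ, ∀ᵐ μ ∂P, Appr μ R₇ R₈ R₉) → (∀ᵐ μ ∂P, ∀ p : EuclideanSpace ℝ (Fin 3), μ {p} ≠ 0 → ∀ y : EuclideanSpace ℝ (Fin 3),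 (∀ q : EuclideanSpace ℝ (Fin 3), μ {q} ≠ 0 → q ≠ p → y ≠ q) → ∑' q : {q : EuclideanSpace ℝ (Fin 3) // μ {q} ≠ 0 ∧ q ≠ p}, Literature.MathematicalPhysics.StatisticalMechanics.lennardJones (dist p (q : EuclideanSpace ℝ (Fin 3))) ≤ ∑' q : {q : EuclideanSpace ℝ (Fin 3) // μ {q} ≠ 0 ∧ q ≠ p}, Literature.MathematicalPhysics.StatisticalMechanics.lennardJones (dist y (q : EuclideanSpace ℝ (Fin 3)))) → P {μ : MeasureTheory.Measure (EuclideanSpace ℝ (Fin 3)) | ∃ Q : Literature.MathematicalPhysics.StatisticalMechanics.PeriodicConfiguration 3, ∃ t : EuclideanSpace ℝ (Fin 3), {p : EuclideanSpace ℝ (Fin 3) | μ {p} ≠ 0} = (fun s => s + t) '' Q.points} = 0 → (∀ A : Set (MeasureTheory.Measure (EuclideanSpace ℝ (Fin 3))), MeasurableSet A → (∀ μ : MeasureTheory.Measure (EuclideanSpace ℝ (Fin 3)), ∀ p : EuclideanSpace ℝ (Fin 3), μ {p} ≠ 0 → (μ ∈ A ↔ MeasureTheory.Measure.map (fun z : EuclideanSpace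 ℝ (Fin 3) => z - p) μ ∈ A)) → P A = 0 ∨ P Aᶜ = 0) → (⨅ Q : Literature.MathematicalPhysics.StatisticalMechanics.PeriodicConfiguration 3, Q.energyPerParticle Literature.MathematicalPhysics.StatisticalMechanics.lennardJones) < (∫ μ, Literature.MathematicalPhysics.StatisticalMechanics.rootEnergy Literature.MathematicalPhysics.StatisticalMechanics.lennardJones μ ∂P)) ↔
    (∀ δ : ℝ, 0 < δ → ∀ P : MeasureTheory.Measure (MeasureTheory.Measure (EuclideanSpace ℝ (Fin 3))), let Gy : ℝ → (N : ℕ) → (Fin N → EuclideanSpace ℝ (Fin 3)) → Fin N → Prop := fun η N y j => let d : ℝ := sInf ((fun z => dist z (y (j : Fin N))) '' (Set.range (y) \ {(y (j : Fin N))})); let T : Set (EuclideanSpace ℝ (Fin 3)) := {z : EuclideanSpace ℝ (Fin 3) | z ∈ Set.range (y) ∧ z ≠ (y (j : Fin N)) ∧ dist z (y (j : Fin N)) < 13 / 10 * d}; ∃ A : EuclideanSpace ℝ (Fin 3) →ₗᵢ[ℝ] EuclideanSpace ℝ (Fin 3), (∃ e : ↥T ≃ ↥Literature.Geometry.DiscreteGeometry.fccKissingPattern,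 ∀ t : ↥T, dist (d⁻¹ • ((t : EuclideanSpace ℝ (Fin 3)) - (y (j : Fin N)))) (A ((e t : ↥Literature.Geometry.DiscreteGeometry.fccKissingPattern) : EuclideanSpace ℝ (Fin 3))) ≤ η) ∨ (∃ e : ↥T ≃ ↥Literature.Geometry.DiscreteGeometry.hcpKissingPattern, ∀ t : ↥T, dist (d⁻¹ • ((t : EuclideanSpace ℝ (Fin 3)) - (y (j : Fin N)))) (A ((e t : ↥Literature.Geometry.DiscreteGeometry.hcpKissingPattern) : EuclideanSpace ℝ (Fin 3))) ≤ η); let TexBall : (N : ℕ) → (Fin N → EuclideanSpace ℝ (Fin 3)) → Fin N → ℝ → ℝ → ℝ → ℝ → Prop := fun N y i R R₇ R₈ R₉ => (∀ a b : Fin N, a ≠ b → (7 : ℝ) / 10 ≤ dist (y a) (y b)) ∧ (∀ j : Fin N, dist (y j) (y i) ≤ R → ¬ Gy (1 / 20) N (y) j) ∧ (∀ j : Fin N, dist (y j) (y i) ≤ R → ¬ ((∀ j' : Fin N, dist (y j') (y j) ≤ R₇ → ¬ Gy (1 / 20) N (y) j') ∧ (∀ z : EuclideanSpace ℝ (Fin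 3), dist z (y j) ≤ R₇ → ∃ k : Fin N, dist z (y k) ≤ 1) ∧ (∀ j' : Fin N, dist (y j') (y j) ≤ R₇ → (let d : ℝ := sInf ((fun z => dist z (y j')) '' (Set.range (y) \ {(y j')})); ∀ k : Fin N, y k ≠ y j' → dist (y k) (y j') < 27 / 20 * d → 5 ≤ Nat.card {m : Fin N // y m ≠ y j' ∧ dist (y m) (y j') < 27 / 20 * d ∧ y m ≠ y k ∧ dist (y m) (y k) < 27 / 20 * d})))) ∧ (∀ j : Fin N, dist (y j) (y i) ≤ R → ∃ k : Fin N, dist (y k) (y j) ≤ R₈ ∧ Gy (1 / 8) N (y) k) ∧ (∀ j : Fin N, dist (y j) (y i) ≤ R → ¬ ((∀ j' : Fin N, dist (y j') (y j) ≤ R₉ → ¬ Gy (1 / 20) N (y) j') ∧ (Nat.card {j' : Fin N // dist (y j') (y j) ≤ R₉ ∧ ¬ Gy (1 / 8) N (y) j'} : ℝ) ≤ 1 / 2 * (Nat.card {j' : Fin N // dist (y j') (y j) ≤ R₉} : ℝ) ∧ (∀ j' : Fin N, dist (y j') (y j) ≤ R₉ → ¬ Gy (1 / 8) N (y) j' →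 ¬ (let d : ℝ := sInf ((fun z => dist z (y j')) '' (Set.range (y) \ {(y j')})); ∀ k : Fin N, y k ≠ y j' → dist (y k) (y j') < 27 / 20 * d → 5 ≤ Nat.card {m : Fin N // y m ≠ y j' ∧ dist (y m) (y j') < 27 / 20 * d ∧ y m ≠ y k ∧ dist (y m) (y k) < 27 / 20 * d})))); let Appr : MeasureTheory.Measure (EuclideanSpace ℝ (Fin 3)) → ℝ → ℝ → ℝ → Prop := fun μ R₇ R₈ R₉ => ∀ q : EuclideanSpace ℝ (Fin 3), μ {q} ≠ 0 → ∀ R ε : ℝ, 0 < ε → ∃ (N : ℕ) (y : Fin N → EuclideanSpace ℝ (Fin 3)) (i : Fin N), TexBall N y i R R₇ R₈ R₉ ∧ (∀ p : EuclideanSpace ℝ (Fin 3), μ {p} ≠ 0 → dist p q ≤ R → ∃ k : Fin N, dist (y k - y i) (p - q) ≤ ε) ∧ (∀ k : Fin N, dist (y k) (y i) ≤ R → ∃ p : EuclideanSpace ℝ (Fin 3), μ {p} ≠ 0 ∧ dist (y k - y i) (p - q) ≤ ε); MeasureTheory.IsProbabilityMeasure P → (∀ᵐ μ ∂P, Literature.Probability.Process.IsRootedHardCore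 δ μ) → Literature.Probability.Process.IsPointStationaryLaw P → (∃ R₇ R₈ R₉ : ℝ, ∀ᵐ μ ∂P, Appr μ R₇ R₈ R₉) → (∀ᵐ μ ∂P, ∀ p : EuclideanSpace ℝ (Fin 3), μ {p} ≠ 0 → ∀ y : EuclideanSpace ℝ (Fin 3), (∀ q : EuclideanSpace ℝ (Fin 3), μ {q} ≠ 0 → q ≠ p → y ≠ q) → ∑' q : {q : EuclideanSpace ℝ (Fin 3) // μ {q} ≠ 0 ∧ q ≠ p}, Literature.MathematicalPhysics.StatisticalMechanics.lennardJones (dist p (q : EuclideanSpace ℝ (Fin 3))) ≤ ∑' q : {q : EuclideanSpace ℝ (Fin 3) // μ {q} ≠ 0 ∧ q ≠ p}, Literature.MathematicalPhysics.StatisticalMechanics.lennardJones (dist y (q : EuclideanSpace ℝ (Fin 3)))) → P {μ : MeasureTheory.Measure (EuclideanSpace ℝ (Fin 3)) | ∃ Q : Literature.MathematicalPhysics.StatisticalMechanics.PeriodicConfiguration 3, ∃ t : EuclideanSpace ℝ (Fin 3), {p : EuclideanSpace ℝ (Fin 3) | μ {p} ≠ 0} = (fun s => s + t) '' Q.points}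 = 0 → (∀ A : Set (MeasureTheory.Measure (EuclideanSpace ℝ (Fin 3))), MeasurableSet A → (∀ μ : MeasureTheory.Measure (EuclideanSpace ℝ (Fin 3)), ∀ p : EuclideanSpace ℝ (Fin 3), μ {p} ≠ 0 → (μ ∈ A ↔ MeasureTheory.Measure.map (fun z : EuclideanSpace ℝ (Fin 3) => z - p) μ ∈ A)) → P A = 0 ∨ P Aᶜ = 0) → (∀ᵐ μ ∂P, {p : EuclideanSpace ℝ (Fin 3) | μ {p} ≠ 0}.Infinite) → (⨅ Q : Literature.MathematicalPhysics.StatisticalMechanics.PeriodicConfiguration 3, Q.energyPerParticle Literature.MathematicalPhysics.StatisticalMechanics.lennardJones) < (∫ μ, Literature.MathematicalPhysics.StatisticalMechanics.rootEnergy Literature.MathematicalPhysics.StatisticalMechanics.lennardJones μ ∂P)) := by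
  constructor
  · intro h δ hδ P
    have h' := h δ hδ P
    dsimp only at h' ⊢
    intro hP ha hb hd he h0 herg _
    exact h' hP ha hb hd he h0 herg
  · intro h δ hδ P
    have h' := h δ hδ P
    dsimp only at h' ⊢
    intro hP ha hb hd he h0 herg
    have hA : MeasurableSet {μ : Measure E3 | μ univ = ∞} :=
      (Measure.measurable_coe MeasurableSet.univ) (measurableSet_singleton ∞)
    have hinv : ∀ μ : Measure E3, ∀ p : E3, μ {p} ≠ 0 →
        (μ ∈ {μ : Measure E3 | μ univ = ∞} ↔ Measure.map (fun z : E3 => z - p) μ ∈ {μ : Measure E3 | μ univ = ∞}) :=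
      fun μ p _ => by simp only [Set.mem_setOf_eq, map_sub_univ]
    rcases herg _ hA hinv with hfin | hinf
    · -- almost every configuration is finite: the finite-cluster gap
      refine eStar_lt_integral_rootEnergy_of_ae_finite hδ ha hb ?_
      filter_upwards [ha, measure_eq_zero_iff_ae_notMem.1 hfin] with μ hμ hμ'
      obtain ⟨S, h0S, hsep, rfl⟩ := hμ
      rw [setOf_count_restrict_singleton_ne_zero]
      by_contra hS
      exact hμ' (count_restrict_univ_of_infinite hS)
    · -- almost every configuration is infinite: the hypothesis
      refine h' hP ha hb hd he h0 herg ?_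
      filter_upwards [ha, measure_eq_zero_iff_ae_notMem.1 hinf] with μ hμ hμ'
      obtain ⟨S, h0S, hsep, rfl⟩ := hμ
      rw [setOf_count_restrict_singleton_ne_zero]
      intro hS
      exact hμ' (fun h => ENNReal.natCast_ne_top _ ((count_restrict_univ_of_finite hS).symm.trans h))

end Stub


/-! ## §4. The GENERIC exact cut of the registered stub by a settled re-rooting-invariant class

For the registered (ergodic) stub the cut needs no conditioning: by the stub's own ergodicity clause every re-rooting-invariant
Giry-measurable class `K` is almost surely entered or almost surely avoided.  `aperiodicErgodicGap_cut`: if `S_aperiodicErgodicGap` holds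
for the laws almost surely carried by `K` (a settled class), it is EQUIVALENT to its restriction to the laws almost surely carried by `Kᶜ`;
`aperiodicErgodicGap_iff_infiniteCase` is the instance `K = {μ | μ univ ≠ ∞}`. -/

section GenericCut

/-- **GENERIC EXACT CUT of the registered stub by a settled re-rooting-invariant class.**  For a Giry-measurable event `K` invariant under
re-rooting at atoms: if `S_aperiodicErgodicGap` holds for the laws almost surely carried by `K` (hypothesis: the stub verbatim with the extra
hypothesis `∀ᵐ μ ∂P, μ ∈ K`), then the stub (verbatim, left) is equivalent to its restriction to laws almost surely carried by `Kᶜ`. [folklore] -/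
theorem aperiodicErgodicGap_cut (K : Set (MeasureTheory.Measure (EuclideanSpace ℝ (Fin 3)))) (hK : MeasurableSet K)
    (hinvK : ∀ μ : MeasureTheory.Measure (EuclideanSpace ℝ (Fin 3)), ∀ p : EuclideanSpace ℝ (Fin 3), μ {p} ≠ 0 →
      (μ ∈ K ↔ MeasureTheory.Measure.map (fun z : EuclideanSpace ℝ (Fin 3) => z - p) μ ∈ K))
    (hgapK : ∀ δ : ℝ, 0 < δ → ∀ P : MeasureTheory.Measure (MeasureTheory.Measure (EuclideanSpace ℝ (Fin 3))), let Gy : ℝ → (N : ℕ) → (Fin N → EuclideanSpace ℝ (Fin 3)) → Fin N → Prop := fun η N y j => let d : ℝ := sInf ((fun z => dist z (y (j : Fin N))) '' (Set.range (y) \ {(y (j : Fin N))})); let T : Set (EuclideanSpace ℝ (Fin 3)) := {z : EuclideanSpace ℝ (Fin 3) | z ∈ Set.range (y) ∧ z ≠ (y (j : Fin N)) ∧ dist z (y (j : Fin N)) < 13 / 10 * d}; ∃ A : EuclideanSpace ℝ (Fin 3) →ₗᵢ[ℝ] EuclideanSpace ℝ (Fin 3), (∃ e : ↥T ≃ ↥Literature.Geometry.DiscreteGeometry.fccKissingPattern,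 ∀ t : ↥T, dist (d⁻¹ • ((t : EuclideanSpace ℝ (Fin 3)) - (y (j : Fin N)))) (A ((e t : ↥Literature.Geometry.DiscreteGeometry.fccKissingPattern) : EuclideanSpace ℝ (Fin 3))) ≤ η) ∨ (∃ e : ↥T ≃ ↥Literature.Geometry.DiscreteGeometry.hcpKissingPattern, ∀ t : ↥T, dist (d⁻¹ • ((t : EuclideanSpace ℝ (Fin 3)) - (y (j : Fin N)))) (A ((e t : ↥Literature.Geometry.DiscreteGeometry.hcpKissingPattern) : EuclideanSpace ℝ (Fin 3))) ≤ η); let TexBall : (N : ℕ) → (Fin N → EuclideanSpace ℝ (Fin 3)) → Fin N → ℝ → ℝ → ℝ → ℝ → Prop := fun N y i R R₇ R₈ R₉ => (∀ a b : Fin N, a ≠ b → (7 : ℝ) / 10 ≤ dist (y a) (y b)) ∧ (∀ j : Fin N, dist (y j) (y i) ≤ R → ¬ Gy (1 / 20) N (y) j) ∧ (∀ j : Fin N, dist (y j) (y i) ≤ R → ¬ ((∀ j' : Fin N, dist (y j') (y j) ≤ R₇ → ¬ Gy (1 / 20) N (y) j') ∧ (∀ z : EuclideanSpace ℝ (Fin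 3), dist z (y j) ≤ R₇ → ∃ k : Fin N, dist z (y k) ≤ 1) ∧ (∀ j' : Fin N, dist (y j') (y j) ≤ R₇ → (let d : ℝ := sInf ((fun z => dist z (y j')) '' (Set.range (y) \ {(y j')})); ∀ k : Fin N, y k ≠ y j' → dist (y k) (y j') < 27 / 20 * d → 5 ≤ Nat.card {m : Fin N // y m ≠ y j' ∧ dist (y m) (y j') < 27 / 20 * d ∧ y m ≠ y k ∧ dist (y m) (y k) < 27 / 20 * d})))) ∧ (∀ j : Fin N, dist (y j) (y i) ≤ R → ∃ k : Fin N, dist (y k) (y j) ≤ R₈ ∧ Gy (1 / 8) N (y) k) ∧ (∀ j : Fin N, dist (y j) (y i) ≤ R → ¬ ((∀ j' : Fin N, dist (y j') (y j) ≤ R₉ → ¬ Gy (1 / 20) N (y) j') ∧ (Nat.card {j' : Fin N // dist (y j') (y j) ≤ R₉ ∧ ¬ Gy (1 / 8) N (y) j'} : ℝ) ≤ 1 / 2 * (Nat.card {j' : Fin N // dist (y j') (y j) ≤ R₉} : ℝ) ∧ (∀ j' : Fin N, dist (y j') (y j) ≤ R₉ → ¬ Gy (1 / 8) N (y) j' →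 ¬ (let d : ℝ := sInf ((fun z => dist z (y j')) '' (Set.range (y) \ {(y j')})); ∀ k : Fin N, y k ≠ y j' → dist (y k) (y j') < 27 / 20 * d → 5 ≤ Nat.card {m : Fin N // y m ≠ y j' ∧ dist (y m) (y j') < 27 / 20 * d ∧ y m ≠ y k ∧ dist (y m) (y k) < 27 / 20 * d})))); let Appr : MeasureTheory.Measure (EuclideanSpace ℝ (Fin 3)) → ℝ → ℝ → ℝ → Prop := fun μ R₇ R₈ R₉ => ∀ q : EuclideanSpace ℝ (Fin 3), μ {q} ≠ 0 → ∀ R ε : ℝ, 0 < ε → ∃ (N : ℕ) (y : Fin N → EuclideanSpace ℝ (Fin 3)) (i : Fin N), TexBall N y i R R₇ R₈ R₉ ∧ (∀ p : EuclideanSpace ℝ (Fin 3), μ {p} ≠ 0 → dist p q ≤ R → ∃ k : Fin N, dist (y k - y i) (p - q) ≤ ε) ∧ (∀ k : Fin N, dist (y k) (y i) ≤ R → ∃ p : EuclideanSpace ℝ (Fin 3), μ {p} ≠ 0 ∧ dist (y k - y i) (p - q) ≤ ε); MeasureTheory.IsProbabilityMeasure P → (∀ᵐ μ ∂P, Literature.Probability.Process.IsRootedHardCore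 δ μ) → Literature.Probability.Process.IsPointStationaryLaw P → (∃ R₇ R₈ R₉ : ℝ, ∀ᵐ μ ∂P, Appr μ R₇ R₈ R₉) → (∀ᵐ μ ∂P, ∀ p : EuclideanSpace ℝ (Fin 3), μ {p} ≠ 0 → ∀ y : EuclideanSpace ℝ (Fin 3), (∀ q : EuclideanSpace ℝ (Fin 3), μ {q} ≠ 0 → q ≠ p → y ≠ q) → ∑' q : {q : EuclideanSpace ℝ (Fin 3) // μ {q} ≠ 0 ∧ q ≠ p}, Literature.MathematicalPhysics.StatisticalMechanics.lennardJones (dist p (q : EuclideanSpace ℝ (Fin 3))) ≤ ∑' q : {q : EuclideanSpace ℝ (Fin 3) // μ {q} ≠ 0 ∧ q ≠ p}, Literature.MathematicalPhysics.StatisticalMechanics.lennardJones (dist y (q : EuclideanSpace ℝ (Fin 3)))) → P {μ : MeasureTheory.Measure (EuclideanSpace ℝ (Fin 3)) | ∃ Q : Literature.MathematicalPhysics.StatisticalMechanics.PeriodicConfiguration 3, ∃ t : EuclideanSpace ℝ (Fin 3), {p : EuclideanSpace ℝ (Fin 3) | μ {p} ≠ 0} = (fun s => s + t) '' Q.points}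 = 0 → (∀ A : Set (MeasureTheory.Measure (EuclideanSpace ℝ (Fin 3))), MeasurableSet A → (∀ μ : MeasureTheory.Measure (EuclideanSpace ℝ (Fin 3)), ∀ p : EuclideanSpace ℝ (Fin 3), μ {p} ≠ 0 → (μ ∈ A ↔ MeasureTheory.Measure.map (fun z : EuclideanSpace ℝ (Fin 3) => z - p) μ ∈ A)) → P A = 0 ∨ P Aᶜ = 0) → (∀ᵐ μ ∂P, μ ∈ K) → (⨅ Q : Literature.MathematicalPhysics.StatisticalMechanics.PeriodicConfiguration 3, Q.energyPerParticle Literature.MathematicalPhysics.StatisticalMechanics.lennardJones) < (∫ μ, Literature.MathematicalPhysics.StatisticalMechanics.rootEnergy Literature.MathematicalPhysics.StatisticalMechanics.lennardJones μ ∂P)) :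
    (∀ δ : ℝ, 0 < δ → ∀ P : MeasureTheory.Measure (MeasureTheory.Measure (EuclideanSpace ℝ (Fin 3))), let Gy : ℝ → (N : ℕ) → (Fin N → EuclideanSpace ℝ (Fin 3)) → Fin N → Prop := fun η N y j => let d : ℝ := sInf ((fun z => dist z (y (j : Fin N))) '' (Set.range (y) \ {(y (j : Fin N))})); let T : Set (EuclideanSpace ℝ (Fin 3)) := {z : EuclideanSpace ℝ (Fin 3) | z ∈ Set.range (y) ∧ z ≠ (y (j : Fin N)) ∧ dist z (y (j : Fin N)) < 13 / 10 * d}; ∃ A : EuclideanSpace ℝ (Fin 3) →ₗᵢ[ℝ] EuclideanSpace ℝ (Fin 3), (∃ e : ↥T ≃ ↥Literature.Geometry.DiscreteGeometry.fccKissingPattern, ∀ t : ↥T, dist (d⁻¹ • ((t : EuclideanSpace ℝ (Fin 3)) - (y (j : Fin N)))) (A ((e t : ↥Literature.Geometry.DiscreteGeometry.fccKissingPattern) : EuclideanSpace ℝ (Fin 3))) ≤ η) ∨ (∃ e : ↥T ≃ ↥Literature.Geometry.DiscreteGeometry.hcpKissingPattern, ∀ t : ↥T, dist (d⁻¹ •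 ((t : EuclideanSpace ℝ (Fin 3)) - (y (j : Fin N)))) (A ((e t : ↥Literature.Geometry.DiscreteGeometry.hcpKissingPattern) : EuclideanSpace ℝ (Fin 3))) ≤ η); let TexBall : (N : ℕ) → (Fin N → EuclideanSpace ℝ (Fin 3)) → Fin N → ℝ → ℝ → ℝ → ℝ → Prop := fun N y i R R₇ R₈ R₉ => (∀ a b : Fin N, a ≠ b → (7 : ℝ) / 10 ≤ dist (y a) (y b)) ∧ (∀ j : Fin N, dist (y j) (y i) ≤ R → ¬ Gy (1 / 20) N (y) j) ∧ (∀ j : Fin N, dist (y j) (y i) ≤ R → ¬ ((∀ j' : Fin N, dist (y j') (y j) ≤ R₇ → ¬ Gy (1 / 20) N (y) j') ∧ (∀ z : EuclideanSpace ℝ (Fin 3), dist z (y j) ≤ R₇ → ∃ k : Fin N, dist z (y k) ≤ 1) ∧ (∀ j' : Fin N, dist (y j') (y j) ≤ R₇ → (let d : ℝ := sInf ((fun z => dist z (y j')) '' (Set.range (y) \ {(y j')})); ∀ k : Fin N, y k ≠ y j' → dist (y k) (y j') < 27 / 20 * d → 5 ≤ Nat.card {m : Fin N // y m ≠ y j'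 ∧ dist (y m) (y j') < 27 / 20 * d ∧ y m ≠ y k ∧ dist (y m) (y k) < 27 / 20 * d})))) ∧ (∀ j : Fin N, dist (y j) (y i) ≤ R → ∃ k : Fin N, dist (y k) (y j) ≤ R₈ ∧ Gy (1 / 8) N (y) k) ∧ (∀ j : Fin N, dist (y j) (y i) ≤ R → ¬ ((∀ j' : Fin N, dist (y j') (y j) ≤ R₉ → ¬ Gy (1 / 20) N (y) j') ∧ (Nat.card {j' : Fin N // dist (y j') (y j) ≤ R₉ ∧ ¬ Gy (1 / 8) N (y) j'} : ℝ) ≤ 1 / 2 * (Nat.card {j' : Fin N // dist (y j') (y j) ≤ R₉} : ℝ) ∧ (∀ j' : Fin N, dist (y j') (y j) ≤ R₉ → ¬ Gy (1 / 8) N (y) j' → ¬ (let d : ℝ := sInf ((fun z => dist z (y j')) '' (Set.range (y) \ {(y j')})); ∀ k : Fin N, y k ≠ y j' → dist (y k) (y j') < 27 / 20 * d → 5 ≤ Nat.card {m : Fin N // y m ≠ y j' ∧ dist (y m) (y j') < 27 / 20 * d ∧ y m ≠ y k ∧ dist (y m) (y k) < 27 / 20 * d})))); let Appr : MeasureTheory.Measure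 (EuclideanSpace ℝ (Fin 3)) → ℝ → ℝ → ℝ → Prop := fun μ R₇ R₈ R₉ => ∀ q : EuclideanSpace ℝ (Fin 3), μ {q} ≠ 0 → ∀ R ε : ℝ, 0 < ε → ∃ (N : ℕ) (y : Fin N → EuclideanSpace ℝ (Fin 3)) (i : Fin N), TexBall N y i R R₇ R₈ R₉ ∧ (∀ p : EuclideanSpace ℝ (Fin 3), μ {p} ≠ 0 → dist p q ≤ R → ∃ k : Fin N, dist (y k - y i) (p - q) ≤ ε) ∧ (∀ k : Fin N, dist (y k) (y i) ≤ R → ∃ p : EuclideanSpace ℝ (Fin 3), μ {p} ≠ 0 ∧ dist (y k - y i) (p - q) ≤ ε); MeasureTheory.IsProbabilityMeasure P → (∀ᵐ μ ∂P, Literature.Probability.Process.IsRootedHardCore δ μ) → Literature.Probability.Process.IsPointStationaryLaw P → (∃ R₇ R₈ R₉ : ℝ, ∀ᵐ μ ∂P, Appr μ R₇ R₈ R₉) → (∀ᵐ μ ∂P, ∀ p : EuclideanSpace ℝ (Fin 3), μ {p} ≠ 0 → ∀ y : EuclideanSpace ℝ (Fin 3), (∀ q : EuclideanSpace ℝ (Fin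 3), μ {q} ≠ 0 → q ≠ p → y ≠ q) → ∑' q : {q : EuclideanSpace ℝ (Fin 3) // μ {q} ≠ 0 ∧ q ≠ p}, Literature.MathematicalPhysics.StatisticalMechanics.lennardJones (dist p (q : EuclideanSpace ℝ (Fin 3))) ≤ ∑' q : {q : EuclideanSpace ℝ (Fin 3) // μ {q} ≠ 0 ∧ q ≠ p}, Literature.MathematicalPhysics.StatisticalMechanics.lennardJones (dist y (q : EuclideanSpace ℝ (Fin 3)))) → P {μ : MeasureTheory.Measure (EuclideanSpace ℝ (Fin 3)) | ∃ Q : Literature.MathematicalPhysics.StatisticalMechanics.PeriodicConfiguration 3, ∃ t : EuclideanSpace ℝ (Fin 3), {p : EuclideanSpace ℝ (Fin 3) | μ {p} ≠ 0} = (fun s => s + t) '' Q.points} = 0 → (∀ A : Set (MeasureTheory.Measure (EuclideanSpace ℝ (Fin 3))), MeasurableSet A → (∀ μ : MeasureTheory.Measure (EuclideanSpace ℝ (Fin 3)), ∀ p : EuclideanSpace ℝ (Fin 3), μ {p} ≠ 0 → (μ ∈ A ↔ MeasureTheory.Measure.map (fun z : EuclideanSpace ℝ (Fin 3) => z - p)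 μ ∈ A)) → P A = 0 ∨ P Aᶜ = 0) → (⨅ Q : Literature.MathematicalPhysics.StatisticalMechanics.PeriodicConfiguration 3, Q.energyPerParticle Literature.MathematicalPhysics.StatisticalMechanics.lennardJones) < (∫ μ, Literature.MathematicalPhysics.StatisticalMechanics.rootEnergy Literature.MathematicalPhysics.StatisticalMechanics.lennardJones μ ∂P)) ↔
    (∀ δ : ℝ, 0 < δ → ∀ P : MeasureTheory.Measure (MeasureTheory.Measure (EuclideanSpace ℝ (Fin 3))), let Gy : ℝ → (N : ℕ) → (Fin N → EuclideanSpace ℝ (Fin 3)) → Fin N → Prop := fun η N y j => let d : ℝ := sInf ((fun z => dist z (y (j : Fin N))) '' (Set.range (y) \ {(y (j : Fin N))})); let T : Set (EuclideanSpace ℝ (Fin 3)) := {z : EuclideanSpace ℝ (Fin 3) | z ∈ Set.range (y) ∧ z ≠ (y (j : Fin N)) ∧ dist z (y (j : Fin N)) < 13 / 10 * d}; ∃ A : EuclideanSpace ℝ (Fin 3) →ₗᵢ[ℝ] EuclideanSpace ℝ (Fin 3), (∃ e : ↥T ≃ ↥Literature.Geometry.DiscreteGeometry.fccKissingPattern,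 ∀ t : ↥T, dist (d⁻¹ • ((t : EuclideanSpace ℝ (Fin 3)) - (y (j : Fin N)))) (A ((e t : ↥Literature.Geometry.DiscreteGeometry.fccKissingPattern) : EuclideanSpace ℝ (Fin 3))) ≤ η) ∨ (∃ e : ↥T ≃ ↥Literature.Geometry.DiscreteGeometry.hcpKissingPattern, ∀ t : ↥T, dist (d⁻¹ • ((t : EuclideanSpace ℝ (Fin 3)) - (y (j : Fin N)))) (A ((e t : ↥Literature.Geometry.DiscreteGeometry.hcpKissingPattern) : EuclideanSpace ℝ (Fin 3))) ≤ η); let TexBall : (N : ℕ) → (Fin N → EuclideanSpace ℝ (Fin 3)) → Fin N → ℝ → ℝ → ℝ → ℝ → Prop := fun N y i R R₇ R₈ R₉ => (∀ a b : Fin N, a ≠ b → (7 : ℝ) / 10 ≤ dist (y a) (y b)) ∧ (∀ j : Fin N, dist (y j) (y i) ≤ R → ¬ Gy (1 / 20) N (y) j) ∧ (∀ j : Fin N, dist (y j) (y i) ≤ R → ¬ ((∀ j' : Fin N, dist (y j') (y j) ≤ R₇ → ¬ Gy (1 / 20) N (y) j') ∧ (∀ z : EuclideanSpace ℝ (Fin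 3), dist z (y j) ≤ R₇ → ∃ k : Fin N, dist z (y k) ≤ 1) ∧ (∀ j' : Fin N, dist (y j') (y j) ≤ R₇ → (let d : ℝ := sInf ((fun z => dist z (y j')) '' (Set.range (y) \ {(y j')})); ∀ k : Fin N, y k ≠ y j' → dist (y k) (y j') < 27 / 20 * d → 5 ≤ Nat.card {m : Fin N // y m ≠ y j' ∧ dist (y m) (y j') < 27 / 20 * d ∧ y m ≠ y k ∧ dist (y m) (y k) < 27 / 20 * d})))) ∧ (∀ j : Fin N, dist (y j) (y i) ≤ R → ∃ k : Fin N, dist (y k) (y j) ≤ R₈ ∧ Gy (1 / 8) N (y) k) ∧ (∀ j : Fin N, dist (y j) (y i) ≤ R → ¬ ((∀ j' : Fin N, dist (y j') (y j) ≤ R₉ → ¬ Gy (1 / 20) N (y) j') ∧ (Nat.card {j' : Fin N // dist (y j') (y j) ≤ R₉ ∧ ¬ Gy (1 / 8) N (y) j'} : ℝ) ≤ 1 / 2 * (Nat.card {j' : Fin N // dist (y j') (y j) ≤ R₉} : ℝ) ∧ (∀ j' : Fin N, dist (y j') (y j) ≤ R₉ → ¬ Gy (1 / 8) N (y) j' →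 ¬ (let d : ℝ := sInf ((fun z => dist z (y j')) '' (Set.range (y) \ {(y j')})); ∀ k : Fin N, y k ≠ y j' → dist (y k) (y j') < 27 / 20 * d → 5 ≤ Nat.card {m : Fin N // y m ≠ y j' ∧ dist (y m) (y j') < 27 / 20 * d ∧ y m ≠ y k ∧ dist (y m) (y k) < 27 / 20 * d})))); let Appr : MeasureTheory.Measure (EuclideanSpace ℝ (Fin 3)) → ℝ → ℝ → ℝ → Prop := fun μ R₇ R₈ R₉ => ∀ q : EuclideanSpace ℝ (Fin 3), μ {q} ≠ 0 → ∀ R ε : ℝ, 0 < ε → ∃ (N : ℕ) (y : Fin N → EuclideanSpace ℝ (Fin 3)) (i : Fin N), TexBall N y i R R₇ R₈ R₉ ∧ (∀ p : EuclideanSpace ℝ (Fin 3), μ {p} ≠ 0 → dist p q ≤ R → ∃ k : Fin N, dist (y k - y i) (p - q) ≤ ε) ∧ (∀ k : Fin N, dist (y k) (y i) ≤ R → ∃ p : EuclideanSpace ℝ (Fin 3), μ {p} ≠ 0 ∧ dist (y k - y i) (p - q) ≤ ε); MeasureTheory.IsProbabilityMeasure P → (∀ᵐ μ ∂P, Literature.Probability.Process.IsRootedHardCore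 δ μ) → Literature.Probability.Process.IsPointStationaryLaw P → (∃ R₇ R₈ R₉ : ℝ, ∀ᵐ μ ∂P, Appr μ R₇ R₈ R₉) → (∀ᵐ μ ∂P, ∀ p : EuclideanSpace ℝ (Fin 3), μ {p} ≠ 0 → ∀ y : EuclideanSpace ℝ (Fin 3), (∀ q : EuclideanSpace ℝ (Fin 3), μ {q} ≠ 0 → q ≠ p → y ≠ q) → ∑' q : {q : EuclideanSpace ℝ (Fin 3) // μ {q} ≠ 0 ∧ q ≠ p}, Literature.MathematicalPhysics.StatisticalMechanics.lennardJones (dist p (q : EuclideanSpace ℝ (Fin 3))) ≤ ∑' q : {q : EuclideanSpace ℝ (Fin 3) // μ {q} ≠ 0 ∧ q ≠ p}, Literature.MathematicalPhysics.StatisticalMechanics.lennardJones (dist y (q : EuclideanSpace ℝ (Fin 3)))) → P {μ : MeasureTheory.Measure (EuclideanSpace ℝ (Fin 3)) | ∃ Q : Literature.MathematicalPhysics.StatisticalMechanics.PeriodicConfiguration 3, ∃ t : EuclideanSpace ℝ (Fin 3), {p : EuclideanSpace ℝ (Fin 3) | μ {p} ≠ 0} = (fun s => s + t) '' Q.points}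 = 0 → (∀ A : Set (MeasureTheory.Measure (EuclideanSpace ℝ (Fin 3))), MeasurableSet A → (∀ μ : MeasureTheory.Measure (EuclideanSpace ℝ (Fin 3)), ∀ p : EuclideanSpace ℝ (Fin 3), μ {p} ≠ 0 → (μ ∈ A ↔ MeasureTheory.Measure.map (fun z : EuclideanSpace ℝ (Fin 3) => z - p) μ ∈ A)) → P A = 0 ∨ P Aᶜ = 0) → (∀ᵐ μ ∂P, μ ∈ Kᶜ) → (⨅ Q : Literature.MathematicalPhysics.StatisticalMechanics.PeriodicConfiguration 3, Q.energyPerParticle Literature.MathematicalPhysics.StatisticalMechanics.lennardJones) < (∫ μ, Literature.MathematicalPhysics.StatisticalMechanics.rootEnergy Literature.MathematicalPhysics.StatisticalMechanics.lennardJones μ ∂P)) := by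
  constructor
  · intro h δ hδ P
    have h' := h δ hδ P
    dsimp only at h' ⊢
    intro hP ha hb hd he h0 herg _
    exact h' hP ha hb hd he h0 herg
  · intro h δ hδ P
    have h' := h δ hδ P
    have hG := hgapK δ hδ P
    dsimp only at h' hG ⊢
    intro hP ha hb hd he h0 herg
    rcases herg _ hK hinvK with hKnull | hKcnull
    · exact h' hP ha hb hd he h0 herg (measure_eq_zero_iff_ae_notMem.1 hKnull)
    · exact hG hP ha hb hd he h0 herg ((measure_eq_zero_iff_ae_notMem.1 hKcnull).mono fun μ hμ => not_not.1 hμ)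

end GenericCut

end Summit.AtomisticToContinuum.Crystallization.Theorems.FrustratedLawDichotomyFiniteClusterGap

end
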